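import Summits.Langlands.Langlands.Theses.QuarterDeficit1951

/-!
# Sketch — crux-ideate round 1, ideator 2, crux `CensusDeficit1951` (stmt-Langlands-17933)

First lemmas of the two idea cards filed by this seat, stated over existing declarations.

* Card `second-resident-format-kill`:
  `not_censusDeficit1951_of_two_window_forms` (PROVED) — two linearly independent window cusp forms
  on `(Γ₀(1951), χ)` for ONE order-5 `χ` (any parity, NO Hecke hypothesis, NO fingerprint) refute the
  crux: every certified transcript then has upper count `U ∉ {0, 1}`, so `certifiesDeficit = false`
  (format soundness `not_inWindow_of_upperCount_eq_zero` / `window_subsingleton_of_upperCount_eq_one`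
  + completeness of `IsJointSpectralData`).
* Card `pu-glued-odd-quasimode`:
  `glued_quotient_slash_odd` (PROVED, construction lemma) — the partition-of-unity quotient
  `u♯ = V / Ψ` of a `χ`-automorphic odd numerator by a `Γ₀(1951)`-invariant even non-vanishing
  denominator is `χ`-automorphic and odd: exact automorphy and exact parity of the glued trial
  function hold BY CONSTRUCTION (no pullback, no smoothing, no matching theorem).
-/

namespace Summit.Langlands.Langlands.Cruxes.CensusDeficit1951.Ideator2

open Literature.NumberTheory.Automorphic
open scoped ComplexConjugate

/-- **Second-resident format kill.** If for one order-5 character `χ` mod 1951 there are two window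
cusp forms `u₀, u₁` (`IsMaassCuspFormOn`, `|λᵢ − 1/4| ≤ 1/100`, `u₀ ≢ 0`, `u₁` not a multiple of
`u₀`), then `CensusDeficit1951` is false: a certified deficit transcript for `χ` has `U = 0`
(no window line — contradicted by `u₀`) or `U = 1` (window lines form a subsingleton — but `u₀, u₁`
force two window lines, or one window line whose eigenspace contains two independent vectors).
No Hecke operator, fingerprint or parity enters. [folklore] -/
theorem not_censusDeficit1951_of_two_window_forms
    (χ : DirichletCharacter ℂ 1951) (hχ : orderOf χ = 5)
    (u₀ u₁ : UpperHalfPlane → ℂ) (lam₀ lam₁ : ℝ)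
    (h₀ : IsMaassCuspFormOn 1951 χ u₀ lam₀) (h₁ : IsMaassCuspFormOn 1951 χ u₁ lam₁)
    (hne : ∃ z, u₀ z ≠ 0) (hind : ∀ a : ℂ, u₁ ≠ a • u₀)
    (hw₀ : |lam₀ - 1 / 4| ≤ 1 / 100) (hw₁ : |lam₁ - 1 / 4| ≤ 1 / 100) :
    ¬ Summit.Langlands.Langlands.Theses.QuarterDeficit1951.CensusDeficit1951 := by
  intro hC
  obtain ⟨c, hw, -, -, hc, hv⟩ := hC χ hχ
  unfold CertifiedMaassHeckeTraceCensus at hc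
  obtain ⟨-, hwf, J, d, hJ, hE⟩ := hc
  obtain ⟨ub, hform, hHecke, hli, hspan⟩ := hJ.exists_eigenbasis
  have hw' : ((1 / 100 : ℚ) : ℝ) ≤ (c.window : ℝ) := by exact_mod_cast hw
  push_cast at hw'
  have hu0 : u₀ ≠ 0 := by
    obtain ⟨z, hz⟩ := hne
    exact fun h => hz (by simp [h])
  have hu1 : u₁ ≠ 0 := fun h => hind 0 (by rw [h, zero_smul])
  -- every non-zero cusp form of eigenvalue `lam` produces a line of the spectral data at `lam`
  have hline : ∀ (v : UpperHalfPlane → ℂ) (lam : ℝ), IsMaassCuspFormOn 1951 χ v lam → v ≠ 0 →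
      ∃ j, (d j).lam = lam := by
    intro v lam hv hv0
    by_contra hno
    push Not at hno
    have hempty : {j | (d j).lam = lam} = (∅ : Set J) :=
      Set.eq_empty_iff_forall_notMem.mpr fun j hj => hno j hj
    have hmem := hspan v lam hv
    rw [hempty, Set.image_empty, Submodule.span_empty] at hmem
    exact hv0 ((Submodule.mem_bot ℂ).mp hmem)
  obtain ⟨j₀, hj₀⟩ := hline u₀ lam₀ h₀ hu0
  obtain ⟨j₁, hj₁⟩ := hline u₁ lam₁ h₁ hu1
  have hwin₀ : c.inWindow (d j₀).lam := by
    rw [MaassHeckeTraceCensus.inWindow, hj₀]; exact hw₀.trans hw'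
  have hwin₁ : c.inWindow (d j₁).lam := by
    rw [MaassHeckeTraceCensus.inWindow, hj₁]; exact hw₁.trans hw'
  unfold MaassHeckeTraceCensus.certifiesDeficit at hv
  simp only [Bool.and_eq_true, Bool.or_eq_true, beq_iff_eq, List.any_eq_true] at hv
  obtain ⟨-, hU | ⟨hU, -⟩⟩ := hv
  · exact MaassHeckeTraceCensus.not_inWindow_of_upperCount_eq_zero hJ hE hwf hU j₀ hwin₀
  · have huniq : ∀ j, c.inWindow (d j).lam → j = j₀ := fun j hj =>
      MaassHeckeTraceCensus.window_subsingleton_of_upperCount_eq_one hJ hE hwf hU hj hwin₀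
    -- the eigenvalue-`lam₀` lines, and the eigenvalue-`lam₁` lines, are all the single line `j₀`
    have hS : ∀ lam : ℝ, |lam - 1 / 4| ≤ 1 / 100 → {j | (d j).lam = lam} ⊆ ({j₀} : Set J) := by
      intro lam hlam j hj
      simp only [Set.mem_setOf_eq] at hj
      have : c.inWindow (d j).lam := by
        rw [MaassHeckeTraceCensus.inWindow, hj]; exact hlam.trans hw'
      exact Set.mem_singleton_iff.mpr (huniq j this)
    have hmem : ∀ (v : UpperHalfPlane → ℂ) (lam : ℝ), IsMaassCuspFormOn 1951 χ v lam →
        |lam - 1 / 4| ≤ 1 / 100 → ∃ a : ℂ, a • ub j₀ = v := by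
      intro v lam hv hlam
      have h1 := hspan v lam hv
      have h2 : Submodule.span ℂ (ub '' {j | (d j).lam = lam}) ≤ Submodule.span ℂ {ub j₀} := by
        refine Submodule.span_mono ?_
        intro x hx
        obtain ⟨j, hj, rfl⟩ := hx
        have := hS lam hlam hj
        rw [Set.mem_singleton_iff] at this
        simp [this]
      exact Submodule.mem_span_singleton.mp (h2 h1)
    obtain ⟨a, ha⟩ := hmem u₀ lam₀ h₀ hw₀
    obtain ⟨b, hb⟩ := hmem u₁ lam₁ h₁ hw₁
    have ha0 : a ≠ 0 := by
      rintro rfl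
      exact hu0 (by rw [← ha, zero_smul])
    refine hind (b / a) ?_
    rw [← ha, ← hb, smul_smul, div_mul_cancel₀ b ha0]

/-- **Glued quotient: exact automorphy and parity by construction.** If `V` is `χ`-automorphic on
`Γ₀(1951)` and odd under the reflection `J : z ↦ −z̄`, and `Ψ` is `Γ₀(1951)`-invariant and even
(the partition-of-unity denominator, a sum of incomplete-Eisenstein-type cutoffs over both cusp
charts), then `u♯ = V / Ψ` is `χ`-automorphic and odd. (Where `Ψ ≥ 1`, which holds on a
fundamental domain when the cutoff height is below half the two-chart injectivity height
`√3/(2·1951)`, no junk division occurs; the lemma itself is unconditional algebra.) [folklore] -/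
theorem glued_quotient_slash_odd (χ : DirichletCharacter ℂ 1951) (V Ψ : UpperHalfPlane → ℂ)
    (hV : ∀ γ : Matrix.SpecialLinearGroup (Fin 2) ℤ, γ ∈ CongruenceSubgroup.Gamma0 1951 →
      ∀ z : UpperHalfPlane, V (γ • z) = χ ((γ 1 1 : ℤ) : ZMod 1951) * V z)
    (hΨ : ∀ γ : Matrix.SpecialLinearGroup (Fin 2) ℤ, γ ∈ CongruenceSubgroup.Gamma0 1951 →
      ∀ z : UpperHalfPlane, Ψ (γ • z) = Ψ z)
    (hVodd : ∀ z : UpperHalfPlane, V (UpperHalfPlane.J • z) = -V z)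
    (hΨeven : ∀ z : UpperHalfPlane, Ψ (UpperHalfPlane.J • z) = Ψ z) :
    (∀ γ : Matrix.SpecialLinearGroup (Fin 2) ℤ, γ ∈ CongruenceSubgroup.Gamma0 1951 →
        ∀ z : UpperHalfPlane, V (γ • z) / Ψ (γ • z) = χ ((γ 1 1 : ℤ) : ZMod 1951) * (V z / Ψ z)) ∧
      (∀ z : UpperHalfPlane, V (UpperHalfPlane.J • z) / Ψ (UpperHalfPlane.J • z) = -(V z / Ψ z)) := by
  refine ⟨fun γ hγ z => ?_, fun z => ?_⟩
  · rw [hV γ hγ z, hΨ γ hγ z, mul_div_assoc]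
  · rw [hVodd z, hΨeven z, neg_div]

end Summit.Langlands.Langlands.Cruxes.CensusDeficit1951.Ideator2
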